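import Summits.QuantumFields.YangMills.Theorems.FemtoTransferGapSpectralSumsRootMeans
import Literature.Analysis.UnboundedOperators.LinearizedBoltzmannCoercivity1D
import HarnessLib

/-!
# BLOCK-TO-FINE ROOT INEQUALITIES, part 3: ★ the three door inequalities (a) JENSEN ROOT, (b) REVERSE JENSEN ROOT, (c) DEFECT CONTRACTION
# (door `BlockToFine` of crux idea «block-endpoint» on crux `DressedRitz`, stmt-QuantumFields-20205; LEAD prover ym-lead-20205-polyakovlift g4)

Notation as in part 2 (`S_p = Σ_k λ_k^p a_k²`, block length `ℓ ≥ 1`; the once-dressed vector `u = K^ℓ v` has `‖u‖² = S_{2ℓ}`, `⟨u,Ku⟩ = S_{2ℓ+1}`,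
`‖Ku‖² = S_{2ℓ+2}`, `⟨u,K^ℓu⟩ = S_{3ℓ}`, `⟨u,K^{2ℓ}u⟩ = S_{4ℓ}`).  Under the two block-defect hypotheses `S_{2ℓ}·nv ≤ (1+δ) S_ℓ²` (`A ≤ nv`) and
`S_{4ℓ} S_{2ℓ} ≤ (1+δ) S_{3ℓ}²` with `0 ≤ δ ≤ 1/32` and `S_{2ℓ} > 0`:

* ★ `jensen_root` (a): `S_{2ℓ+1}^ℓ ≤ S_{3ℓ} · S_{2ℓ}^{ℓ-1}` (power mean; needs no defect hypothesis);
* ★ `mean_root_lower` (b′): `X̄^{1/ℓ} (1 − 10δ/ℓ) S_{2ℓ} ≤ S_{2ℓ+1}`, `X̄ = S_{3ℓ}/S_{2ℓ}`;  ★ `reverse_jensen_root` (b): `S_{3ℓ} S_{2ℓ}^{ℓ-1} ≤ e^{15δ} S_{2ℓ+1}^ℓ`;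
* ★★ `defect_contraction` (c): `S_{2ℓ+2} S_{2ℓ} − S_{2ℓ+1}² ≤ (600 δ/ℓ²) · S_{2ℓ+1}²` — the fine one-step defect of a once-block-dressed vector is the
  block defect divided by `ℓ²`.

Mechanism: means comparability (part 2), then the pointwise inequalities of part 1 at `s = λ_k/X̄^{1/ℓ}` summed with non-negative weights —
near/up atoms are charged to the dressed defect, far-down atoms to the raw defect.  Constants are crude (numerically the sharp ones are ≈ 0.5 in (b)
and ≈ 1 in (c); crux idea card `Cruxes/DressedRitz/Ideas/block-endpoint.md`, ym-cruxidea-20205-2).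

HONEST FRAMING: real-analysis plumbing for the femto-universe infrastructure of the CONDITIONAL rung R2b1; nothing here bears on infinite volume, the
continuum limit or the Clay gap.  References: Reed–Simon IV, Thm. XIII.1 [cite: ReedSimonIV1978, Thm. XIII.1]; power-mean / Jensen inequality [folklore].
-/

set_option autoImplicit false

noncomputable section

open Finset
open scoped BigOperators

namespace Summit.QuantumFields.YangMills.Theorems.FemtoTransferGap.SpecSum

open Root

variable {lam a : ℕ → ℝ} {ℓ : ℕ} {A nv Sl S2l S2l1 S2l2 S3l S4l δ : ℝ}

/-- ★ **(a) JENSEN ROOT**: `S_{2ℓ+1}^ℓ ≤ S_{3ℓ} · S_{2ℓ}^{ℓ−1}` — the fine Rayleigh quotient of `u = K^ℓ v` to the `ℓ`-th power is at most its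
block Rayleigh quotient (power mean; tangent of `x ↦ x^ℓ` summed with the dressed weights). [cite: ReedSimonIV1978, Thm. XIII.1] -/
theorem jensen_root (hnn : ∀ k, 0 ≤ lam k) (hℓ : 1 ≤ ℓ) (hS2l : HasSum (fun k => lam k ^ (2 * ℓ) * a k ^ 2) S2l)
    (hS2l1 : HasSum (fun k => lam k ^ (2 * ℓ + 1) * a k ^ 2) S2l1) (hS3l : HasSum (fun k => lam k ^ (3 * ℓ) * a k ^ 2) S3l)
    (hpos : 0 < S2l) : S2l1 ^ ℓ ≤ S3l * S2l ^ (ℓ - 1) := by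
  have hℓne : ℓ ≠ 0 := by omega
  have h3 : 0 ≤ S3l := hS3l.nonneg fun k => mul_nonneg (pow_nonneg (hnn k) _) (sq_nonneg _)
  have h21 : 0 ≤ S2l1 := hS2l1.nonneg fun k => mul_nonneg (pow_nonneg (hnn k) _) (sq_nonneg _)
  set y := S2l1 / S2l with hy
  have hy0 : 0 ≤ y := div_nonneg h21 hpos.le
  rcases hy0.eq_or_lt with hyz | hypos
  · have : S2l1 = 0 := by
      have := hyz.symm; rw [hy, div_eq_zero_iff] at this
      rcases this with h | h
      · exact h
      · exact absurd h hpos.ne'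
    rw [this, zero_pow hℓne]; positivity
  · -- tangent inequality summed with weights λ^{2ℓ} a²
    have hL : HasSum (fun k => lam k ^ (2 * ℓ) * a k ^ 2 * (y ^ ℓ + ℓ * y ^ (ℓ - 1) * (lam k - y)))
        (y ^ ℓ * S2l + ℓ * y ^ (ℓ - 1) * (S2l1 - y * S2l)) := by
      have := (hS2l.mul_left (y ^ ℓ)).add ((hS2l1.sub (hS2l.mul_left y)).mul_left (ℓ * y ^ (ℓ - 1)))
      refine this.congr_fun fun k => ?_
      simp only [pow_two_mul_add_one_eq, pow_two_mul_eq]; ring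
    have hR : HasSum (fun k => lam k ^ (2 * ℓ) * a k ^ 2 * lam k ^ ℓ) S3l := by
      refine hS3l.congr_fun fun k => ?_
      simp only [pow_two_mul_eq, pow_three_mul_eq]; ring
    have hle := hasSum_le (fun k => mul_le_mul_of_nonneg_left (tangent_pow_le (hnn k) hypos hℓ)
      (mul_nonneg (pow_nonneg (hnn k) _) (sq_nonneg _))) hL hR
    have hzero : S2l1 - y * S2l = 0 := by rw [hy]; field_simp; ring
    rw [hzero, mul_zero, add_zero] at hle
    -- S2l1^ℓ = y^ℓ S2l^ℓ = (y^ℓ S2l) S2l^{ℓ-1}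
    have hS : S2l1 = y * S2l := by rw [hy]; field_simp
    obtain ⟨n, rfl⟩ : ∃ n, ℓ = n + 1 := ⟨ℓ - 1, by omega⟩
    rw [Nat.add_sub_cancel, hS, mul_pow]
    calc y ^ (n + 1) * S2l ^ (n + 1) = (y ^ (n + 1) * S2l) * S2l ^ n := by ring
      _ ≤ S3l * S2l ^ n := mul_le_mul_of_nonneg_right hle (pow_nonneg hpos.le _)

/-- ★ **(b′) MEAN ROOT LOWER BOUND**: under both block defects (`δ ≤ 1/32`), the dressed mean of `λ` is at least `(1 − 10δ/ℓ)` times the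
`ℓ`-th root of the dressed mean of `λ^ℓ`:  `X̄^{1/ℓ}·(1 − 10δ/ℓ)·S_{2ℓ} ≤ S_{2ℓ+1}`, `X̄ = S_{3ℓ}/S_{2ℓ}`. [cite: ReedSimonIV1978, Thm. XIII.1] -/
theorem mean_root_lower (hnn : ∀ k, 0 ≤ lam k) (hℓ : 1 ≤ ℓ) (hA : HasSum (fun k => a k ^ 2) A)
    (hSl : HasSum (fun k => lam k ^ ℓ * a k ^ 2) Sl) (hS2l : HasSum (fun k => lam k ^ (2 * ℓ) * a k ^ 2) S2l)
    (hS2l1 : HasSum (fun k => lam k ^ (2 * ℓ + 1) * a k ^ 2) S2l1) (hS3l : HasSum (fun k => lam k ^ (3 * ℓ) * a k ^ 2) S3l)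
    (hS4l : HasSum (fun k => lam k ^ (4 * ℓ) * a k ^ 2) S4l) (hpos : 0 < S2l) (hAnv : A ≤ nv) (hδ0 : 0 ≤ δ) (hδ : δ ≤ 1 / 32)
    (H1 : S2l * nv ≤ (1 + δ) * Sl ^ 2) (H2 : S4l * S2l ≤ (1 + δ) * S3l ^ 2) :
    (S3l / S2l) ^ ((ℓ : ℝ)⁻¹) * (1 - 10 * δ / ℓ) * S2l ≤ S2l1 := by
  have hℓne : ℓ ≠ 0 := by omega
  have hℓpos : (0 : ℝ) < ℓ := by exact_mod_cast hℓ
  have hApos := bessel_pos hA hS2l hpos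
  have hSlpos := Sl_pos hnn hSl hS2l hpos
  have hS3lpos := S3l_pos hnn hSl hS2l hS3l hpos
  set m := Sl / A with hm
  set Xb := S3l / S2l with hXb
  have hXbpos : 0 < Xb := div_pos hS3lpos hpos
  have hmpos : 0 < m := div_pos hSlpos hApos
  have hmXb : m ≤ Xb := raw_mean_le_dressed_mean hnn hA hSl hS2l hS3l hpos
  have hcmp : Xb < 4 * m := means_cmp hnn hA hSl hS2l hS3l hS4l hpos hAnv hδ0 hδ H1 H2
  set ρ := m / Xb with hρ
  have hρ1 : ρ ≤ 1 := (div_le_one hXbpos).2 hmXb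
  have hρ4 : 1 / 4 ≤ ρ := by rw [hρ, le_div_iff₀ hXbpos]; linarith
  set xb := Xb ^ ((ℓ : ℝ)⁻¹) with hxb
  have hxbpos : 0 < xb := Real.rpow_pos_of_pos hXbpos _
  have hxbℓ : xb ^ ℓ = Xb := by rw [hxb, Real.rpow_inv_natCast_pow hXbpos.le hℓne]
  -- pointwise, in λ-variables
  have hpt : ∀ k, xb * ((lam k ^ ℓ) ^ 2 * a k ^ 2) + xb / ℓ * ((lam k ^ ℓ) ^ 3 * a k ^ 2 / Xb - (lam k ^ ℓ) ^ 2 * a k ^ 2)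
      - 9 * xb / (ℓ * Xb ^ 2) * ((lam k ^ ℓ) ^ 2 * a k ^ 2 * (lam k ^ ℓ - Xb) ^ 2) - xb / ℓ * (a k ^ 2 * (lam k ^ ℓ - m) ^ 2)
      ≤ (lam k ^ ℓ) ^ 2 * lam k * a k ^ 2 := by
    intro k
    have hs0 : 0 ≤ lam k / xb := div_nonneg (hnn k) hxbpos.le
    have hb := root_pointwise_b hs0 hρ4 hρ1 hℓ
    have hsl : (lam k / xb) ^ ℓ = lam k ^ ℓ / Xb := by rw [div_pow, hxbℓ]
    rw [hsl] at hb
    have hC : 0 ≤ a k ^ 2 * Xb ^ 2 * xb := by positivity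
    have h2 := mul_le_mul_of_nonneg_left hb hC
    have hL : a k ^ 2 * Xb ^ 2 * xb * ((lam k ^ ℓ / Xb) ^ 2 * (1 + (lam k ^ ℓ / Xb - 1) / ℓ) -
        (9 * (lam k ^ ℓ / Xb) ^ 2 * (lam k ^ ℓ / Xb - 1) ^ 2 + (lam k ^ ℓ / Xb - ρ) ^ 2) / ℓ) =
        xb * ((lam k ^ ℓ) ^ 2 * a k ^ 2) + xb / ℓ * ((lam k ^ ℓ) ^ 3 * a k ^ 2 / Xb - (lam k ^ ℓ) ^ 2 * a k ^ 2)
        - 9 * xb / (ℓ * Xb ^ 2) * ((lam k ^ ℓ) ^ 2 * a k ^ 2 * (lam k ^ ℓ - Xb) ^ 2) - xb / ℓ * (a k ^ 2 * (lam k ^ ℓ - m) ^ 2) := by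
      rw [hρ]; field_simp; ring
    have hR : a k ^ 2 * Xb ^ 2 * xb * ((lam k ^ ℓ / Xb) ^ 2 * (lam k / xb)) = (lam k ^ ℓ) ^ 2 * lam k * a k ^ 2 := by
      field_simp
    rw [hL, hR] at h2
    exact h2
  -- the sums of both sides
  have hV2 := hasSum_dressed_centred hS2l hS3l hS4l Xb
  have hV1 := hasSum_raw_centred hA hSl hS2l m
  have hX2 : HasSum (fun k => (lam k ^ ℓ) ^ 2 * a k ^ 2) S2l := hS2l.congr_fun fun k => by rw [pow_two_mul_eq]
  have hX3 : HasSum (fun k => (lam k ^ ℓ) ^ 3 * a k ^ 2) S3l := hS3l.congr_fun fun k => by rw [pow_three_mul_eq]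
  have hV2' : HasSum (fun k => (lam k ^ ℓ) ^ 2 * a k ^ 2 * (lam k ^ ℓ - Xb) ^ 2) (S4l - 2 * Xb * S3l + Xb ^ 2 * S2l) :=
    hV2.congr_fun fun k => by rw [pow_two_mul_eq]
  have hLsum : HasSum (fun k => xb * ((lam k ^ ℓ) ^ 2 * a k ^ 2) + xb / ℓ * ((lam k ^ ℓ) ^ 3 * a k ^ 2 / Xb - (lam k ^ ℓ) ^ 2 * a k ^ 2)
      - 9 * xb / (ℓ * Xb ^ 2) * ((lam k ^ ℓ) ^ 2 * a k ^ 2 * (lam k ^ ℓ - Xb) ^ 2) - xb / ℓ * (a k ^ 2 * (lam k ^ ℓ - m) ^ 2))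
      (xb * S2l + xb / ℓ * (S3l / Xb - S2l) - 9 * xb / (ℓ * Xb ^ 2) * (S4l - 2 * Xb * S3l + Xb ^ 2 * S2l)
        - xb / ℓ * (S2l - 2 * m * Sl + m ^ 2 * A)) :=
    (((hX2.mul_left xb).add (((hX3.div_const Xb).sub hX2).mul_left (xb / ℓ))).sub (hV2'.mul_left _)).sub (hV1.mul_left _)
  have hRsum : HasSum (fun k => (lam k ^ ℓ) ^ 2 * lam k * a k ^ 2) S2l1 :=
    hS2l1.congr_fun fun k => by rw [pow_two_mul_add_one_eq]
  have hle := hasSum_le hpt hLsum hRsum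
  -- evaluate: S3l/Xb = S2l; V2 ≤ δ Xb² S2l; V1 ≤ δ S2l
  have hS3Xb : S3l / Xb - S2l = 0 := by rw [hXb]; field_simp; ring
  have hv1 := raw_var_le hA hSl hS2l hpos hAnv hδ0 H1
  have hv2 := dressed_var_le hpos H2
  rw [← hm] at hv1
  rw [← hXb] at hv2
  have hcoef2 : 0 ≤ 9 * xb / (ℓ * Xb ^ 2) := by positivity
  have hcoef1 : 0 ≤ xb / ℓ := by positivity
  have h9 : 9 * xb / (ℓ * Xb ^ 2) * (S4l - 2 * Xb * S3l + Xb ^ 2 * S2l) ≤ 9 * xb / (ℓ * Xb ^ 2) * (δ * (Xb ^ 2 * S2l)) :=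
    mul_le_mul_of_nonneg_left hv2 hcoef2
  have h1 : xb / ℓ * (S2l - 2 * m * Sl + m ^ 2 * A) ≤ xb / ℓ * (δ * S2l) := mul_le_mul_of_nonneg_left hv1 hcoef1
  have hid9 : 9 * xb / (ℓ * Xb ^ 2) * (δ * (Xb ^ 2 * S2l)) = 9 * (xb * δ * S2l / ℓ) := by field_simp
  have hid1 : xb / ℓ * (δ * S2l) = xb * δ * S2l / ℓ := by field_simp
  have hidg : (S3l / S2l) ^ ((ℓ : ℝ)⁻¹) * (1 - 10 * δ / ℓ) * S2l = xb * S2l - 10 * (xb * δ * S2l / ℓ) := by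
    rw [← hxb]; field_simp
  rw [hidg]
  rw [hS3Xb, mul_zero, add_zero] at hle
  linarith

/-- ★ **(b) REVERSE JENSEN ROOT**: under both block defects (`δ ≤ 1/32`): `S_{3ℓ}·S_{2ℓ}^{ℓ−1} ≤ e^{15δ}·S_{2ℓ+1}^ℓ` — the block Rayleigh quotient of
`u = K^ℓ v` is at most `e^{15δ}` times the `ℓ`-th power of its fine Rayleigh quotient. [cite: ReedSimonIV1978, Thm. XIII.1] -/
theorem reverse_jensen_root (hnn : ∀ k, 0 ≤ lam k) (hℓ : 1 ≤ ℓ) (hA : HasSum (fun k => a k ^ 2) A)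
    (hSl : HasSum (fun k => lam k ^ ℓ * a k ^ 2) Sl) (hS2l : HasSum (fun k => lam k ^ (2 * ℓ) * a k ^ 2) S2l)
    (hS2l1 : HasSum (fun k => lam k ^ (2 * ℓ + 1) * a k ^ 2) S2l1) (hS3l : HasSum (fun k => lam k ^ (3 * ℓ) * a k ^ 2) S3l)
    (hS4l : HasSum (fun k => lam k ^ (4 * ℓ) * a k ^ 2) S4l) (hpos : 0 < S2l) (hAnv : A ≤ nv) (hδ0 : 0 ≤ δ) (hδ : δ ≤ 1 / 32)
    (H1 : S2l * nv ≤ (1 + δ) * Sl ^ 2) (H2 : S4l * S2l ≤ (1 + δ) * S3l ^ 2) :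
    S3l * S2l ^ (ℓ - 1) ≤ Real.exp (15 * δ) * S2l1 ^ ℓ := by
  have hℓne : ℓ ≠ 0 := by omega
  have hℓpos : (0 : ℝ) < ℓ := by exact_mod_cast hℓ
  have hℓ1 : (1 : ℝ) ≤ ℓ := by exact_mod_cast hℓ
  have hS3lpos := S3l_pos hnn hSl hS2l hS3l hpos
  have hb := mean_root_lower hnn hℓ hA hSl hS2l hS2l1 hS3l hS4l hpos hAnv hδ0 hδ H1 H2
  set Xb := S3l / S2l with hXb
  have hXbpos : 0 < Xb := div_pos hS3lpos hpos
  set xb := Xb ^ ((ℓ : ℝ)⁻¹) with hxb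
  have hxbpos : 0 < xb := Real.rpow_pos_of_pos hXbpos _
  have hxbℓ : xb ^ ℓ = Xb := by rw [hxb, Real.rpow_inv_natCast_pow hXbpos.le hℓne]
  set η := 10 * δ / ℓ with hη
  have hη0 : 0 ≤ η := by positivity
  have hη1 : η ≤ 10 / 32 := by
    rw [hη, div_le_iff₀ hℓpos]; nlinarith
  have h1η : 0 < 1 - η := by linarith
  -- y ≥ xb (1 − η)
  set y := S2l1 / S2l with hy
  have hyb : xb * (1 - η) ≤ y := by
    rw [hy, le_div_iff₀ hpos]; linarith
  have hy0 : 0 ≤ y := le_trans (mul_nonneg hxbpos.le h1η.le) hyb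
  -- (1 − η)^ℓ ≥ exp(−ℓ η/(1−η)) ≥ exp(−15 δ)
  have hlog : -(η / (1 - η)) ≤ Real.log (1 - η) := by
    have := Real.one_sub_inv_le_log_of_pos h1η
    have hid : 1 - (1 - η)⁻¹ = -(η / (1 - η)) := by field_simp; ring
    linarith [hid]
  have hexp1 : Real.exp (-(η / (1 - η))) ≤ 1 - η := by
    calc Real.exp (-(η / (1 - η))) ≤ Real.exp (Real.log (1 - η)) := Real.exp_le_exp.2 hlog
      _ = 1 - η := Real.exp_log h1η
  have hexpℓ : Real.exp (-(ℓ * (η / (1 - η)))) ≤ (1 - η) ^ ℓ := by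
    rw [show -(ℓ * (η / (1 - η))) = (ℓ : ℝ) * (-(η / (1 - η))) by ring, Real.exp_nat_mul]
    exact pow_le_pow_left₀ (Real.exp_pos _).le hexp1 ℓ
  have h15 : ℓ * (η / (1 - η)) ≤ 15 * δ := by
    rw [hη]
    rw [show (ℓ : ℝ) * (10 * δ / ℓ / (1 - 10 * δ / ℓ)) = 10 * δ / (1 - 10 * δ / ℓ) by field_simp]
    rw [div_le_iff₀ (by rw [← hη]; exact h1η)]
    rw [← hη]; nlinarith
  have hexp15 : Real.exp (-(15 * δ)) ≤ (1 - η) ^ ℓ :=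
    le_trans (Real.exp_le_exp.2 (by linarith)) hexpℓ
  -- Xb = xb^ℓ ≤ (y/(1−η))^ℓ
  have hxy : xb ≤ y / (1 - η) := by rw [le_div_iff₀ h1η]; exact hyb
  have hXy : Xb * (1 - η) ^ ℓ ≤ y ^ ℓ := by
    have := pow_le_pow_left₀ hxbpos.le hxy ℓ
    rw [hxbℓ, div_pow] at this
    rwa [le_div_iff₀ (pow_pos h1η _)] at this
  have hXexp : Xb * Real.exp (-(15 * δ)) ≤ y ^ ℓ := le_trans (mul_le_mul_of_nonneg_left hexp15 hXbpos.le) hXy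
  -- multiply by exp(15δ) S2l^ℓ
  have hE : Real.exp (15 * δ) * Real.exp (-(15 * δ)) = 1 := by rw [← Real.exp_add]; simp
  have hXb' : Xb ≤ Real.exp (15 * δ) * y ^ ℓ := by
    have := mul_le_mul_of_nonneg_left hXexp (Real.exp_pos (15 * δ)).le
    calc Xb = Real.exp (15 * δ) * Real.exp (-(15 * δ)) * Xb := by rw [hE, one_mul]
      _ = Real.exp (15 * δ) * (Xb * Real.exp (-(15 * δ))) := by ring
      _ ≤ Real.exp (15 * δ) * y ^ ℓ := this
  have hyS : y ^ ℓ * S2l ^ ℓ = S2l1 ^ ℓ := by rw [← mul_pow, hy, div_mul_cancel₀ _ hpos.ne']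
  obtain ⟨n, rfl⟩ : ∃ n, ℓ = n + 1 := ⟨ℓ - 1, by omega⟩
  rw [Nat.add_sub_cancel]
  have hfin : Xb * S2l ^ (n + 1) ≤ Real.exp (15 * δ) * y ^ (n + 1) * S2l ^ (n + 1) :=
    mul_le_mul_of_nonneg_right hXb' (pow_nonneg hpos.le _)
  have hlhs : Xb * S2l ^ (n + 1) = S3l * S2l ^ n := by rw [hXb, pow_succ]; field_simp
  rw [hlhs] at hfin
  calc S3l * S2l ^ n ≤ Real.exp (15 * δ) * y ^ (n + 1) * S2l ^ (n + 1) := hfin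
    _ = Real.exp (15 * δ) * (y ^ (n + 1) * S2l ^ (n + 1)) := by ring
    _ = Real.exp (15 * δ) * S2l1 ^ (n + 1) := by rw [hyS]

/-- End-game algebra of the defect contraction (clean context): from `V ≤ 256·δx̄²S/ℓ² + 2(x̄−y)²S`, `x̄(1−η) ≤ y ≤ x̄`, `η = 10δ/ℓ`,
`δ ≤ 1/32` conclude `V·S ≤ (600δ/ℓ²)(yS)²`. [folklore] -/
theorem defect_algebra {S y xb η δ ℓr V : ℝ} (hS : 0 < S) (hxb : 0 < xb) (hℓ : 1 ≤ ℓr) (hδ0 : 0 ≤ δ) (hδ : δ ≤ 1 / 32)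
    (hη : η = 10 * δ / ℓr) (hyb : xb * (1 - η) ≤ y) (hyx : y ≤ xb)
    (hV : V ≤ 256 * (δ * xb ^ 2 * S / ℓr ^ 2) + 2 * (xb - y) ^ 2 * S) :
    V * S ≤ 600 * δ / ℓr ^ 2 * (y * S) ^ 2 := by
  have hℓpos : 0 < ℓr := by linarith
  have hη0 : 0 ≤ η := by rw [hη]; positivity
  have hη1 : η ≤ 10 / 32 := by
    rw [hη, div_le_iff₀ hℓpos]; nlinarith
  set W := δ * xb ^ 2 * S / ℓr ^ 2 with hW
  have hW0 : 0 ≤ W := by positivity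
  -- (xb − y)² ≤ η² xb²
  have hdev : (xb - y) ^ 2 ≤ η ^ 2 * xb ^ 2 := by
    have h1 : 0 ≤ xb - y := by linarith
    have h2 : xb - y ≤ η * xb := by linarith
    calc (xb - y) ^ 2 ≤ (η * xb) ^ 2 := pow_le_pow_left₀ h1 h2 2
      _ = η ^ 2 * xb ^ 2 := by ring
  -- η² ≤ (100/32) δ / ℓr²
  have hη2 : η ^ 2 ≤ (100 / 32) * δ / ℓr ^ 2 := by
    have h1 : η ^ 2 = 100 * δ ^ 2 / ℓr ^ 2 := by rw [hη]; ring
    have h2 : 100 * δ ^ 2 ≤ (100 / 32) * δ := by nlinarith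
    rw [h1]
    exact div_le_div_of_nonneg_right h2 (by positivity)
  have hdev2 : 2 * (xb - y) ^ 2 * S ≤ 7 * W := by
    have h1 : (xb - y) ^ 2 ≤ (100 / 32) * δ / ℓr ^ 2 * xb ^ 2 :=
      le_trans hdev (mul_le_mul_of_nonneg_right hη2 (sq_nonneg _))
    have h2 := mul_le_mul_of_nonneg_right h1 hS.le
    have hid : (100 / 32) * δ / ℓr ^ 2 * xb ^ 2 * S = (100 / 32) * W := by rw [hW]; field_simp
    rw [hid] at h2
    linarith
  have hV2 : V ≤ 263 * W := by linarith
  -- xb² ≤ (32/22)² y²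
  have hxy2 : xb ^ 2 ≤ (32 / 22) ^ 2 * y ^ 2 := by
    have h1 : xb * (22 / 32) ≤ y := le_trans (mul_le_mul_of_nonneg_left (by linarith) hxb.le) hyb
    have h0 : 0 ≤ xb * (22 / 32) := by positivity
    calc xb ^ 2 = (32 / 22) ^ 2 * (xb * (22 / 32)) ^ 2 := by ring
      _ ≤ (32 / 22) ^ 2 * y ^ 2 := mul_le_mul_of_nonneg_left (pow_le_pow_left₀ h0 h1 2) (by norm_num)
  have hWy : W ≤ (32 / 22) ^ 2 * (δ * y ^ 2 * S / ℓr ^ 2) := by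
    rw [hW]
    have := mul_le_mul_of_nonneg_left hxy2 (by positivity : 0 ≤ δ * S / ℓr ^ 2)
    calc δ * xb ^ 2 * S / ℓr ^ 2 = δ * S / ℓr ^ 2 * xb ^ 2 := by ring
      _ ≤ δ * S / ℓr ^ 2 * ((32 / 22) ^ 2 * y ^ 2) := this
      _ = (32 / 22) ^ 2 * (δ * y ^ 2 * S / ℓr ^ 2) := by ring
  have h0 : 0 ≤ δ * y ^ 2 * S / ℓr ^ 2 := by positivity
  calc V * S ≤ 263 * W * S := mul_le_mul_of_nonneg_right hV2 hS.le
    _ ≤ 263 * ((32 / 22) ^ 2 * (δ * y ^ 2 * S / ℓr ^ 2)) * S :=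
        mul_le_mul_of_nonneg_right (mul_le_mul_of_nonneg_left hWy (by norm_num)) hS.le
    _ = (263 * (32 / 22) ^ 2) * (δ / ℓr ^ 2 * (y * S) ^ 2) := by ring
    _ ≤ 600 * (δ / ℓr ^ 2 * (y * S) ^ 2) := mul_le_mul_of_nonneg_right (by norm_num) (by positivity)
    _ = 600 * δ / ℓr ^ 2 * (y * S) ^ 2 := by ring

/-- ★★ **(c) DEFECT CONTRACTION**: under both block defects (`δ ≤ 1/32`): `S_{2ℓ+2}·S_{2ℓ} − S_{2ℓ+1}² ≤ (600 δ/ℓ²)·S_{2ℓ+1}²` — the fine one-step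
defect of the once-block-dressed vector is the block defect divided by `ℓ²`. [cite: ReedSimonIV1978, Thm. XIII.1] -/
theorem defect_contraction (hnn : ∀ k, 0 ≤ lam k) (hℓ : 1 ≤ ℓ) (hA : HasSum (fun k => a k ^ 2) A)
    (hSl : HasSum (fun k => lam k ^ ℓ * a k ^ 2) Sl) (hS2l : HasSum (fun k => lam k ^ (2 * ℓ) * a k ^ 2) S2l)
    (hS2l1 : HasSum (fun k => lam k ^ (2 * ℓ + 1) * a k ^ 2) S2l1) (hS2l2 : HasSum (fun k => lam k ^ (2 * ℓ + 2) * a k ^ 2) S2l2)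
    (hS3l : HasSum (fun k => lam k ^ (3 * ℓ) * a k ^ 2) S3l) (hS4l : HasSum (fun k => lam k ^ (4 * ℓ) * a k ^ 2) S4l)
    (hpos : 0 < S2l) (hAnv : A ≤ nv) (hδ0 : 0 ≤ δ) (hδ : δ ≤ 1 / 32)
    (H1 : S2l * nv ≤ (1 + δ) * Sl ^ 2) (H2 : S4l * S2l ≤ (1 + δ) * S3l ^ 2) :
    S2l2 * S2l - S2l1 ^ 2 ≤ 600 * δ / (ℓ : ℝ) ^ 2 * S2l1 ^ 2 := by
  have hℓne : ℓ ≠ 0 := by omega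
  have hℓpos : (0 : ℝ) < ℓ := by exact_mod_cast hℓ
  have hℓ1 : (1 : ℝ) ≤ ℓ := by exact_mod_cast hℓ
  have hApos := bessel_pos hA hS2l hpos
  have hSlpos := Sl_pos hnn hSl hS2l hpos
  have hS3lpos := S3l_pos hnn hSl hS2l hS3l hpos
  have hb := mean_root_lower hnn hℓ hA hSl hS2l hS2l1 hS3l hS4l hpos hAnv hδ0 hδ H1 H2
  have ha := jensen_root hnn hℓ hS2l hS2l1 hS3l hpos
  set m := Sl / A with hm
  set Xb := S3l / S2l with hXb
  have hXbpos : 0 < Xb := div_pos hS3lpos hpos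
  have hmpos : 0 < m := div_pos hSlpos hApos
  have hmXb : m ≤ Xb := raw_mean_le_dressed_mean hnn hA hSl hS2l hS3l hpos
  have hcmp : Xb < 4 * m := means_cmp hnn hA hSl hS2l hS3l hS4l hpos hAnv hδ0 hδ H1 H2
  set ρ := m / Xb with hρ
  have hρ1 : ρ ≤ 1 := (div_le_one hXbpos).2 hmXb
  have hρ4 : 1 / 4 ≤ ρ := by rw [hρ, le_div_iff₀ hXbpos]; linarith
  set xb := Xb ^ ((ℓ : ℝ)⁻¹) with hxb
  have hxbpos : 0 < xb := Real.rpow_pos_of_pos hXbpos _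
  have hxbℓ : xb ^ ℓ = Xb := by rw [hxb, Real.rpow_inv_natCast_pow hXbpos.le hℓne]
  set y := S2l1 / S2l with hy
  set η := 10 * δ / ℓ with hη
  -- xb(1−η) ≤ y ≤ xb
  have hyb : xb * (1 - η) ≤ y := by rw [hy, le_div_iff₀ hpos]; linarith
  have hyx : y ≤ xb := by
    -- y^ℓ S2l ≤ S3l ⇒ y^ℓ ≤ Xb = xb^ℓ
    have h21 : 0 ≤ S2l1 := hS2l1.nonneg fun k => mul_nonneg (pow_nonneg (hnn k) _) (sq_nonneg _)
    have hy0 : 0 ≤ y := div_nonneg h21 hpos.le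
    have hyl : y ^ ℓ ≤ xb ^ ℓ := by
      rw [hxbℓ, hXb, le_div_iff₀ hpos, hy, div_pow, div_mul_eq_mul_div, div_le_iff₀ (pow_pos hpos _)]
      obtain ⟨n, hn⟩ : ∃ n, ℓ = n + 1 := ⟨ℓ - 1, by omega⟩
      rw [hn, Nat.add_sub_cancel] at ha
      rw [hn]
      calc S2l1 ^ (n + 1) * S2l ≤ S3l * S2l ^ n * S2l := mul_le_mul_of_nonneg_right ha hpos.le
        _ = S3l * S2l ^ (n + 1) := by ring
    exact (pow_le_pow_iff_left₀ hy0 hxbpos.le hℓne).1 hyl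
  -- pointwise (c): λ^{2ℓ}a²(λ − y)² ≤ (128 xb²/(ℓ² Xb²)) λ^{2ℓ}a²(λ^ℓ−Xb)² + (128 xb²/ℓ²) a²(λ^ℓ−m)² + 2(xb−y)² λ^{2ℓ}a²
  have hpt : ∀ k, (lam k ^ ℓ) ^ 2 * a k ^ 2 * (lam k - y) ^ 2 ≤
      128 * xb ^ 2 / ((ℓ : ℝ) ^ 2 * Xb ^ 2) * ((lam k ^ ℓ) ^ 2 * a k ^ 2 * (lam k ^ ℓ - Xb) ^ 2)
        + 128 * xb ^ 2 / (ℓ : ℝ) ^ 2 * (a k ^ 2 * (lam k ^ ℓ - m) ^ 2) + 2 * (xb - y) ^ 2 * ((lam k ^ ℓ) ^ 2 * a k ^ 2) := by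
    intro k
    have hs0 : 0 ≤ lam k / xb := div_nonneg (hnn k) hxbpos.le
    have hc := root_pointwise_c hs0 hρ4 hρ1 hℓ
    have hsl : (lam k / xb) ^ ℓ = lam k ^ ℓ / Xb := by rw [div_pow, hxbℓ]
    rw [hsl] at hc
    -- λ^{2ℓ}(λ − xb)² = Xb² xb² t² (s−1)²
    have hC : 0 ≤ 2 * a k ^ 2 * Xb ^ 2 * xb ^ 2 := by positivity
    have h2 := mul_le_mul_of_nonneg_left hc hC
    have hL : 2 * a k ^ 2 * Xb ^ 2 * xb ^ 2 * ((lam k ^ ℓ / Xb) ^ 2 * (lam k / xb - 1) ^ 2) =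
        2 * ((lam k ^ ℓ) ^ 2 * a k ^ 2 * (lam k - xb) ^ 2) := by field_simp
    have hR : 2 * a k ^ 2 * Xb ^ 2 * xb ^ 2 * (64 / (ℓ : ℝ) ^ 2 * ((lam k ^ ℓ / Xb) ^ 2 * (lam k ^ ℓ / Xb - 1) ^ 2 + (lam k ^ ℓ / Xb - ρ) ^ 2)) =
        128 * xb ^ 2 / ((ℓ : ℝ) ^ 2 * Xb ^ 2) * ((lam k ^ ℓ) ^ 2 * a k ^ 2 * (lam k ^ ℓ - Xb) ^ 2)
        + 128 * xb ^ 2 / (ℓ : ℝ) ^ 2 * (a k ^ 2 * (lam k ^ ℓ - m) ^ 2) := by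
      rw [hρ]; field_simp; ring
    rw [hL, hR] at h2
    -- (λ − y)² ≤ 2(λ − xb)² + 2(xb − y)²
    have hsplit : (lam k - y) ^ 2 ≤ 2 * (lam k - xb) ^ 2 + 2 * (xb - y) ^ 2 := Literature.Analysis.UnboundedOperators.sq_sub_le_two_mul_sq_add (lam k) xb y
    have hw : 0 ≤ (lam k ^ ℓ) ^ 2 * a k ^ 2 := by positivity
    have h3 := mul_le_mul_of_nonneg_left hsplit hw
    have hid3 : (lam k ^ ℓ) ^ 2 * a k ^ 2 * (2 * (lam k - xb) ^ 2 + 2 * (xb - y) ^ 2) =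
        2 * ((lam k ^ ℓ) ^ 2 * a k ^ 2 * (lam k - xb) ^ 2) + 2 * (xb - y) ^ 2 * ((lam k ^ ℓ) ^ 2 * a k ^ 2) := by ring
    rw [hid3] at h3
    linarith [h3, h2]
  -- sums
  have hX2 : HasSum (fun k => (lam k ^ ℓ) ^ 2 * a k ^ 2) S2l := hS2l.congr_fun fun k => by rw [pow_two_mul_eq]
  have hV2' : HasSum (fun k => (lam k ^ ℓ) ^ 2 * a k ^ 2 * (lam k ^ ℓ - Xb) ^ 2) (S4l - 2 * Xb * S3l + Xb ^ 2 * S2l) :=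
    (hasSum_dressed_centred hS2l hS3l hS4l Xb).congr_fun fun k => by rw [pow_two_mul_eq]
  have hV1 := hasSum_raw_centred hA hSl hS2l m
  have hLsum : HasSum (fun k => (lam k ^ ℓ) ^ 2 * a k ^ 2 * (lam k - y) ^ 2) (S2l2 - 2 * y * S2l1 + y ^ 2 * S2l) := by
    have := (hS2l2.sub (hS2l1.mul_left (2 * y))).add (hS2l.mul_left (y ^ 2))
    refine this.congr_fun fun k => ?_
    simp only [pow_two_mul_eq, pow_two_mul_add_one_eq, pow_two_mul_add_two_eq]; ring
  have hRsum := ((hV2'.mul_left (128 * xb ^ 2 / ((ℓ : ℝ) ^ 2 * Xb ^ 2))).add (hV1.mul_left (128 * xb ^ 2 / (ℓ : ℝ) ^ 2))).add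
    (hX2.mul_left (2 * (xb - y) ^ 2))
  have hle := hasSum_le hpt hLsum hRsum
  have hv1 := raw_var_le hA hSl hS2l hpos hAnv hδ0 H1
  have hv2 := dressed_var_le hpos H2
  rw [← hm] at hv1
  rw [← hXb] at hv2
  have hc2 : 0 ≤ 128 * xb ^ 2 / ((ℓ : ℝ) ^ 2 * Xb ^ 2) := by positivity
  have hc1 : 0 ≤ 128 * xb ^ 2 / (ℓ : ℝ) ^ 2 := by positivity
  have h2 := mul_le_mul_of_nonneg_left hv2 hc2
  have h1 := mul_le_mul_of_nonneg_left hv1 hc1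
  have hid2 : 128 * xb ^ 2 / ((ℓ : ℝ) ^ 2 * Xb ^ 2) * (δ * (Xb ^ 2 * S2l)) = 128 * (δ * xb ^ 2 * S2l / (ℓ : ℝ) ^ 2) := by
    field_simp
  have hid1 : 128 * xb ^ 2 / (ℓ : ℝ) ^ 2 * (δ * S2l) = 128 * (δ * xb ^ 2 * S2l / (ℓ : ℝ) ^ 2) := by
    field_simp
  -- V := S2l2 − 2y S2l1 + y² S2l ≤ 256 δ xb² S2l/ℓ² + 2 (xb−y)² S2l
  have hV : S2l2 - 2 * y * S2l1 + y ^ 2 * S2l ≤ 256 * (δ * xb ^ 2 * S2l / (ℓ : ℝ) ^ 2) + 2 * (xb - y) ^ 2 * S2l := by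
    linarith
  have hVid : (S2l2 - 2 * y * S2l1 + y ^ 2 * S2l) * S2l = S2l2 * S2l - S2l1 ^ 2 := by rw [hy]; field_simp; ring
  have hyS : y * S2l = S2l1 := by rw [hy]; field_simp
  have hfin := defect_algebra hpos hxbpos hℓ1 hδ0 hδ rfl hyb hyx hV
  rw [hVid, hyS] at hfin
  exact hfin

end Summit.QuantumFields.YangMills.Theorems.FemtoTransferGap.SpecSum

end
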